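import Mathlib.Data.NNRat.Order
import Literature.AlgebraicGeometry.Frobenioids.PerfFactorial
import HarnessLib

/-!
# Frobenioids I, §0 / Definition 2.4 (i): primes of a monoid, monoprime components, and the
# monoid half of Proposition 4.1 (ii) — lemmas

Mochizuki, *The geometry of Frobenioids I: the general theory*, Kyushu J. Math. **62** (2008)
293–400, §0 "Monoids" (kurims p. 12: `≼`, primary elements, primes `𝔭`, the submonoids `M_𝔭`),
Definition 2.4 (i)(b) (p. 47: "for every `𝔭 ∈ Prime(M)`, the monoid `M_𝔭` is monoprime") and the
proof of Proposition 4.1 (ii) (p. 76) [cite: MochizukiFrdI2008, §0 p.12].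

Elementary facts used by the §4 proofs ("the structure of the `Φ(A)_𝔭`, where `𝔭 ∈ Prime(Φ(A))`
[cf. Definition 2.4, (i), (b)]", p. 76): for a prime `𝔭` with representative `p`,
`M_𝔭 = 𝔭 ∪ {0} = {c | c = 0 ∨ (c ≠ 0 ∧ c ≼ p)}` and `M_𝔭` is closed under divisors
(§0, from the definition of "primary" alone); in a monoprime monoid divisibility is total, hence so
it is inside each `M_𝔭` of a perf-factorial monoid; consequently ("the necessity of this condition
follows immediately from the structure of the `Φ(A)_𝔭`", Prop. 4.1 (ii), p. 76): if `x + y` is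
primary and `x + y = x' + y'` with `x, x' ≠ 0`, some `0 ≠ x''` satisfies `x'' ≤ x`, `x'' ≤ x'`.
Multiplicative notation as in `Monoids.lean` (`0 ↦ 1`, `+ ↦ *`, `≤ ↦ ∣`). No new definitions.
-/

namespace Literature.AlgebraicGeometry.Frobenioids

open Function

universe u

variable {M : Type u} [CommMonoid M]

/-! ### Primes and their submonoids `M_𝔭` (§0 p. 12) -/

/-- Two elements of the subset `𝔭 ⊆ M` of a prime are `≼`-comparable (they are `≼`-equivalent
primary elements). [cite: MochizukiFrdI2008, §0 p.12] -/
theorem Primes.precsim_of_mem_carrier (𝔭 : Primes M) {a b : M} (ha : a ∈ 𝔭.carrier)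
    (hb : b ∈ 𝔭.carrier) : a ≼ b := by
  obtain ⟨ha', hqa⟩ := ha
  obtain ⟨hb', hqb⟩ := hb
  exact Quotient.exact (s := primarySetoid M) (hqa.trans hqb.symm)

/-- A non-trivial element `≼`-below a member of `𝔭` belongs to `𝔭` (it is primary, §0 p. 12, and in
the same class). [cite: MochizukiFrdI2008, §0 p.12] -/
theorem Primes.mem_carrier_of_precsim (𝔭 : Primes M) {p c : M} (hp : p ∈ 𝔭.carrier) (hc : c ≠ 1)
    (hcp : c ≼ p) : c ∈ 𝔭.carrier := by
  obtain ⟨hp', hqp⟩ := hp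
  refine ⟨hp'.of_precsim hcp hc, ?_⟩
  rw [← hqp]
  exact Quotient.sound (s := primarySetoid M) hcp

/-- Every element of `M_𝔭` is `≼ p` for any `p ∈ 𝔭`. [cite: MochizukiFrdI2008, §0 p.12] -/
theorem Primes.precsim_of_mem_submonoid (𝔭 : Primes M) {p c : M} (hp : p ∈ 𝔭.carrier)
    (hc : c ∈ 𝔭.submonoid) : c ≼ p := by
  induction hc using Submonoid.closure_induction with
  | mem x hx => exact 𝔭.precsim_of_mem_carrier hx hp
  | one => exact Precsim.of_dvd (one_dvd p)
  | mul x y _ _ hx hy =>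
    obtain ⟨m, hm, hxm⟩ := hx
    obtain ⟨n, hn, hyn⟩ := hy
    exact ⟨m + n, Nat.add_pos_left hm n, by rw [pow_add]; exact mul_dvd_mul hxm hyn⟩

/-- `M_𝔭 = 𝔭 ∪ {0}`: the submonoid generated by a prime consists of `0` and the elements of `𝔭`
("each subset `𝔭 ⊆ M` is closed under multiplication by elements of `N_{≥1}`", §0 p. 12, and more:
under sums). [cite: MochizukiFrdI2008, §0 p.12] -/
theorem Primes.mem_submonoid_iff (𝔭 : Primes M) {p : M} (hp : p ∈ 𝔭.carrier) (c : M) :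
    c ∈ 𝔭.submonoid ↔ c = 1 ∨ c ∈ 𝔭.carrier := by
  constructor
  · intro hc
    by_cases h1 : c = 1
    · exact Or.inl h1
    · exact Or.inr (𝔭.mem_carrier_of_precsim hp h1 (𝔭.precsim_of_mem_submonoid hp hc))
  · rintro (rfl | hc)
    · exact 𝔭.submonoid.one_mem
    · exact Submonoid.subset_closure hc

/-- `M_𝔭` is closed under divisors: a divisor of an element of `M_𝔭` lies in `M_𝔭`.
[cite: MochizukiFrdI2008, §0 p.12] -/
theorem Primes.mem_submonoid_of_dvd (𝔭 : Primes M) {c w : M} (hcw : c ∣ w)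
    (hw : w ∈ 𝔭.submonoid) : c ∈ 𝔭.submonoid := by
  obtain ⟨⟨p, hp'⟩, hp⟩ := Quotient.exists_rep 𝔭
  have hpc : p ∈ 𝔭.carrier := ⟨hp', hp⟩
  by_cases h1 : c = 1
  · rw [h1]; exact 𝔭.submonoid.one_mem
  exact (𝔭.mem_submonoid_iff hpc c).mpr (Or.inr (𝔭.mem_carrier_of_precsim hpc h1
    ((Precsim.of_dvd hcw).trans (𝔭.precsim_of_mem_submonoid hpc hw))))

/-- The prime of a primary element contains it. [cite: MochizukiFrdI2008, §0 p.12] -/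
theorem mem_carrier_mk_of_isPrimary {a : M} (ha : IsPrimary a) :
    a ∈ Primes.carrier (Quotient.mk (primarySetoid M) ⟨a, ha⟩) :=
  ⟨ha, rfl⟩

/-! ### Monoprime monoids: divisibility is total (§0 p. 10) -/

/-- In `Λ_{≥0}` (written multiplicatively), for a canonically linearly ordered `Λ`, divisibility is
the order, hence total. [cite: MochizukiFrdI2008, §0 p.10] -/
private theorem dvd_total_of_mulEquiv_multiplicative {N : Type u} [CommMonoid N] {Λ : Type*}
    [AddCommMonoid Λ] [LinearOrder Λ] [CanonicallyOrderedAdd Λ] (e : N ≃* Multiplicative Λ)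
    (a b : N) : a ∣ b ∨ b ∣ a := by
  have key : ∀ x y : N, Multiplicative.toAdd (e x) ≤ Multiplicative.toAdd (e y) → x ∣ y := by
    intro x y h
    obtain ⟨c, hc⟩ := le_iff_exists_add.mp h
    refine ⟨e.symm (Multiplicative.ofAdd c), e.injective ?_⟩
    rw [map_mul, MulEquiv.apply_symm_apply]
    exact Multiplicative.toAdd.injective (by rw [toAdd_mul, toAdd_ofAdd]; exact hc)
  rcases le_total (Multiplicative.toAdd (e a)) (Multiplicative.toAdd (e b)) with h | h
  · exact Or.inl (key a b h)
  · exact Or.inr (key b a h)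

/-- In a monoprime monoid (`≅ ℤ_{≥0}, ℚ_{≥0}` or `ℝ_{≥0}`) any two elements are comparable for `≤`.
[cite: MochizukiFrdI2008, §0 p.10] -/
theorem IsMonoprime.dvd_total {N : Type u} [CommMonoid N] (h : IsMonoprime N) (a b : N) :
    a ∣ b ∨ b ∣ a := by
  rcases h with ⟨⟨⟨e⟩⟩⟩ | ⟨⟨⟨e⟩⟩⟩ | ⟨⟨⟨e⟩⟩⟩
  · exact dvd_total_of_mulEquiv_multiplicative e a b
  · exact dvd_total_of_mulEquiv_multiplicative e a b
  · exact dvd_total_of_mulEquiv_multiplicative e a b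

/-- **Definition 2.4 (i)(b)** in use: in a perf-factorial monoid, any two elements of `M_𝔭` are
comparable for `≤` ("the structure of the `Φ(A)_𝔭`", proof of Prop. 4.1 (ii), p. 76).
[cite: MochizukiFrdI2008, Def. 2.4(i) p.47] -/
theorem IsPerfFactorial.dvd_total_of_mem_submonoid (h : IsPerfFactorial M) (𝔭 : Primes M)
    {a b : M} (ha : a ∈ 𝔭.submonoid) (hb : b ∈ 𝔭.submonoid) : a ∣ b ∨ b ∣ a := by
  rcases (h.isMonoprime 𝔭).dvd_total ⟨a, ha⟩ ⟨b, hb⟩ with h1 | h1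
  · exact Or.inl (by simpa using map_dvd 𝔭.submonoid.subtype h1)
  · exact Or.inr (by simpa using map_dvd 𝔭.submonoid.subtype h1)

/-! ### Proposition 4.1 (ii), the monoid statement: necessity -/

/-- **Proposition 4.1 (ii), necessity in the language of monoids** (FrdI p. 76: "the necessity of
this condition follows immediately from the structure of the `Φ(A)_𝔭` [Definition 2.4, (i), (b)]"):
in a perf-factorial monoid, if `x` and `x + y` are primary and `x + y = x' + y'` with `x' ≠ 0`, then
some `0 ≠ x''` satisfies `x'' ≤ x` and `x'' ≤ x'` (`x, x'` lie in the prime of `x + y`, inside whose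
`M_𝔭` divisibility is total). [cite: MochizukiFrdI2008, Prop. 4.1 (ii) p.76] -/
theorem IsPerfFactorial.exists_common_dvd_of_isPrimary_mul (h : IsPerfFactorial M) {x y x' y' : M}
    (hx : IsPrimary x) (hxy : IsPrimary (x * y)) (hx' : x' ≠ 1) (he : x * y = x' * y') :
    ∃ x'' : M, x'' ≠ 1 ∧ x'' ∣ x ∧ x'' ∣ x' := by
  let 𝔭 : Primes M := Quotient.mk (primarySetoid M) ⟨x * y, hxy⟩
  have hp : x * y ∈ 𝔭.carrier := mem_carrier_mk_of_isPrimary hxy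
  have hxp : x ∈ 𝔭.submonoid := Submonoid.subset_closure
    (𝔭.mem_carrier_of_precsim hp hx.1 (Precsim.of_dvd (Dvd.intro _ rfl)))
  have hx'p : x' ∈ 𝔭.submonoid := Submonoid.subset_closure
    (𝔭.mem_carrier_of_precsim hp hx' (Precsim.of_dvd (Dvd.intro _ he.symm)))
  rcases h.dvd_total_of_mem_submonoid 𝔭 hxp hx'p with h1 | h1
  · exact ⟨x, hx.1, dvd_rfl, h1⟩
  · exact ⟨x', hx', h1, dvd_rfl⟩

end Literature.AlgebraicGeometry.Frobenioids
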